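import Literature.Analysis.FluidPDE.TaoQuantitativeLowPassProducts
import HarnessLib

/-!
# Tao 2021, §2: the dyadic blocks of a low-pass projection, on `L²` functions

Analysis/FluidPDE proof file (theorems only, no named facts), step 8h-1 of the inline programme
for `Literature.Analysis.FluidPDE.tao_quantitative_ess` (Tao 2021, Thm. 1.2).

T. Tao, arXiv:1908.04958v2, §2 p. 7: "`P_{≤N}f = ∑_{k=0}^∞ P_{2^{-k}N} f` and
`P_{>N}f = ∑_{k=1}^∞ P_{2^kN} f` for Schwartz `f`" — i.e. the blocks below the cut-off are
untouched by `P_{≤N}` and the blocks above it are killed. On `L²` functions, with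
`P_{≤m} v = g_κ ⋆ v`, `κ = 2^{m+2}` (`coe_lowPassS`), this file proves by Schwartz density
(`blockS_lowPassS_eq_self`, `blockS_lowPassS_eq_zero`; the maps are linear and continuous
`L² → L^∞`):

* `blockFn_lowPass_eq_self` — `Δ̇_j (g_κ ⋆ u) = Δ̇_j u` for `j + 1 ≤ m`;
* `blockFn_lowPass_eq_zero` — `Δ̇_j (g_κ ⋆ u) = 0` for `m + 2 ≤ j`;
* `…_real`, `…_euclidean` — the same for real scalar functions and real vector fields.

## References

* T. Tao, arXiv:1908.04958v2 (2021), §2 p. 7. [Tao2021QuantitativeNS]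
-/

noncomputable section

open MeasureTheory Set Function Filter Topology SchwartzMap
open scoped ENNReal NNReal FourierTransform Convolution

namespace Literature.Analysis.FluidPDE

open FunctionSpaces Fourier

variable {E : Type*} [NormedAddCommGroup E] [InnerProductSpace ℝ E] [FiniteDimensional ℝ E]
  [MeasurableSpace E] [BorelSpace E]

/-! ## A density principle -/

/-- **Density principle**: if `T u = 0` for Schwartz `u` and `‖T u(x)‖ ≤ C ‖u − a‖_{L²}` for all
`u ∈ L²`, Schwartz `a` and `x` (`C < ∞`), then `T u = 0` for all `u ∈ L²`. [folklore] -/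
theorem eq_zero_of_schwartz_approx {T : (E → ℂ) → E → ℂ} {C : ℝ≥0∞} (hC : C ≠ ∞)
    (hbd : ∀ (u : E → ℂ) (a : 𝓢(E, ℂ)), MemLp u 2 volume → ∀ x,
      ‖T u x‖ₑ ≤ C * eLpNorm (u - (a : E → ℂ)) 2 volume)
    {u : E → ℂ} (hu : MemLp u 2 volume) : T u = 0 := by
  obtain ⟨a, ha⟩ := exists_schwartz_tendsto_eLpNorm_sub hu
  have ha' : Tendsto (fun n => eLpNorm (u - (a n : E → ℂ)) 2 volume) atTop (𝓝 0) :=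
    ha.congr fun n => by rw [← eLpNorm_neg, neg_sub]
  have hlim : Tendsto (fun n => C * eLpNorm (u - (a n : E → ℂ)) 2 volume) atTop (𝓝 0) := by
    have h := ENNReal.Tendsto.const_mul ha' (Or.inr hC)
    rwa [mul_zero] at h
  funext x
  have : ‖T u x‖ₑ ≤ 0 := ge_of_tendsto' hlim fun n => hbd u (a n) hu x
  simpa using this

/-! ## The blocks of a low-pass projection, `L²(E; ℂ)` data -/

/-- The pointwise `L² → L^∞` bound for the linear map `u ↦ Δ̇_j(g_κ ⋆ u) − c Δ̇_j u`
against a Schwartz approximant. [folklore] -/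
theorem enorm_blockFn_lowPass_sub_le {κ : ℝ} (hκ : 0 < κ) (j : ℤ) (c : ℂ) {u : E → ℂ}
    (hu : MemLp u 2 volume) (a : 𝓢(E, ℂ)) (x : E) :
    ‖(blockFn j (lowPassKernel E κ ⋆[ContinuousLinearMap.lsmul ℝ ℝ, volume] u) x - c * blockFn j u x) -
      (blockFn j (lowPassKernel E κ ⋆[ContinuousLinearMap.lsmul ℝ ℝ, volume] (a : E → ℂ)) x -
        c * blockFn j (a : E → ℂ) x)‖ₑ ≤
      (eLpNorm (blockKernel E j) 2 volume * ((∫⁻ y, ‖lowPassKernel E κ y‖ₑ) + ‖c‖ₑ)) *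
        eLpNorm (u - (a : E → ℂ)) 2 volume := by
  haveI : Fact (1 ≤ (2 : ℝ≥0∞)) := ⟨one_le_two⟩
  haveI : ENNReal.HolderConjugate 2 2 := ⟨by rw [inv_one, ENNReal.inv_two_add_inv_two]⟩
  have ha : MemLp (a : E → ℂ) 2 volume := a.memLp 2 volume
  obtain ⟨hLu, -⟩ := memLp_lowPass hκ hu
  obtain ⟨hLa, -⟩ := memLp_lowPass hκ ha
  obtain ⟨hLd, hLdle⟩ := memLp_lowPass hκ (hu.sub ha)
  -- linearity
  have e1 : (blockFn j (lowPassKernel E κ ⋆[ContinuousLinearMap.lsmul ℝ ℝ, volume] u) x - c * blockFn j u x) -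
      (blockFn j (lowPassKernel E κ ⋆[ContinuousLinearMap.lsmul ℝ ℝ, volume] (a : E → ℂ)) x -
        c * blockFn j (a : E → ℂ) x) =
      blockFn j (lowPassKernel E κ ⋆[ContinuousLinearMap.lsmul ℝ ℝ, volume] (u - (a : E → ℂ))) x -
        c * blockFn j (u - (a : E → ℂ)) x := by
    rw [lowPass_sub hκ hu ha, blockFn_sub j hLu hLa, blockFn_sub j hu ha]
    simp only [Pi.sub_apply]
    ring
  rw [e1]
  refine (enorm_sub_le).trans ?_
  have h1 := enorm_blockFn_le j hLd.1 2 2 x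
  have h2 := enorm_blockFn_le j (hu.sub ha).1 2 2 x
  rw [enorm_mul]
  calc ‖blockFn j (lowPassKernel E κ ⋆[ContinuousLinearMap.lsmul ℝ ℝ, volume] (u - (a : E → ℂ))) x‖ₑ +
        ‖c‖ₑ * ‖blockFn j (u - (a : E → ℂ)) x‖ₑ
      ≤ eLpNorm (blockKernel E j) 2 volume * ((∫⁻ y, ‖lowPassKernel E κ y‖ₑ) * eLpNorm (u - (a : E → ℂ)) 2 volume) +
        ‖c‖ₑ * (eLpNorm (blockKernel E j) 2 volume * eLpNorm (u - (a : E → ℂ)) 2 volume) := by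
        gcongr
        exact h1.trans (mul_le_mul' le_rfl hLdle)
    _ = _ := by ring

/-- **`Δ̇_j (g_κ ⋆ u) = Δ̇_j u` for `κ = 2^{m+2}`, `j + 1 ≤ m`, `u ∈ L²(E; ℂ)`.** [folklore] -/
theorem blockFn_lowPass_eq_self {m j : ℤ} (h : j + 1 ≤ m) {u : E → ℂ} (hu : MemLp u 2 volume) :
    blockFn j (lowPassKernel E ((2 : ℝ) ^ (m + 2)) ⋆[ContinuousLinearMap.lsmul ℝ ℝ, volume] u) = blockFn j u := by
  have hκ : (0 : ℝ) < (2 : ℝ) ^ (m + 2) := zpow_pos two_pos _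
  have hS : ∀ a : 𝓢(E, ℂ), blockFn j (lowPassKernel E ((2 : ℝ) ^ (m + 2)) ⋆[ContinuousLinearMap.lsmul ℝ ℝ, volume]
      (a : E → ℂ)) = blockFn j (a : E → ℂ) := fun a => by
    have h0 := congrArg (fun φ : 𝓢(E, ℂ) => (φ : E → ℂ)) (blockS_lowPassS_eq_self (E := E) a h)
    simp only [coe_blockS, coe_lowPassS] at h0
    exact h0
  have hmain := eq_zero_of_schwartz_approx (E := E)
    (T := fun u x => blockFn j (lowPassKernel E ((2 : ℝ) ^ (m + 2)) ⋆[ContinuousLinearMap.lsmul ℝ ℝ, volume] u) x -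
      1 * blockFn j u x)
    (C := eLpNorm (blockKernel E j) 2 volume * ((∫⁻ y, ‖lowPassKernel E ((2 : ℝ) ^ (m + 2)) y‖ₑ) + ‖(1 : ℂ)‖ₑ))
    (ENNReal.mul_ne_top (eLpNorm_blockKernel_lt_top j 2).ne
      (ENNReal.add_ne_top.2 ⟨(integrable_lowPassKernel hκ).2.ne, enorm_ne_top⟩))
    (fun u a hu x => by
      have hb := enorm_blockFn_lowPass_sub_le hκ j 1 hu a x
      rw [hS a] at hb
      simp only [one_mul, sub_self, sub_zero] at hb ⊢
      exact hb) hu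
  funext x
  have := congrFun hmain x
  simp only [one_mul, Pi.zero_apply, sub_eq_zero] at this
  exact this

/-- **`Δ̇_j (g_κ ⋆ u) = 0` for `κ = 2^{m+2}`, `m + 2 ≤ j`, `u ∈ L²(E; ℂ)`.** [folklore] -/
theorem blockFn_lowPass_eq_zero {m j : ℤ} (h : m + 2 ≤ j) {u : E → ℂ} (hu : MemLp u 2 volume) :
    blockFn j (lowPassKernel E ((2 : ℝ) ^ (m + 2)) ⋆[ContinuousLinearMap.lsmul ℝ ℝ, volume] u) = 0 := by
  have hκ : (0 : ℝ) < (2 : ℝ) ^ (m + 2) := zpow_pos two_pos _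
  have hS : ∀ a : 𝓢(E, ℂ), blockFn j (lowPassKernel E ((2 : ℝ) ^ (m + 2)) ⋆[ContinuousLinearMap.lsmul ℝ ℝ, volume]
      (a : E → ℂ)) = 0 := fun a => by
    have h0 := congrArg (fun φ : 𝓢(E, ℂ) => (φ : E → ℂ)) (blockS_lowPassS_eq_zero (E := E) a h)
    simp only [coe_blockS, coe_lowPassS, FunLike.coe_zero] at h0
    exact h0
  have hmain := eq_zero_of_schwartz_approx (E := E)
    (T := fun u x => blockFn j (lowPassKernel E ((2 : ℝ) ^ (m + 2)) ⋆[ContinuousLinearMap.lsmul ℝ ℝ, volume] u) x -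
      0 * blockFn j u x)
    (C := eLpNorm (blockKernel E j) 2 volume * ((∫⁻ y, ‖lowPassKernel E ((2 : ℝ) ^ (m + 2)) y‖ₑ) + ‖(0 : ℂ)‖ₑ))
    (ENNReal.mul_ne_top (eLpNorm_blockKernel_lt_top j 2).ne
      (ENNReal.add_ne_top.2 ⟨(integrable_lowPassKernel hκ).2.ne, enorm_ne_top⟩))
    (fun u a hu x => by
      have hb := enorm_blockFn_lowPass_sub_le hκ j 0 hu a x
      rw [hS a] at hb
      simp only [Pi.zero_apply, zero_mul, sub_zero] at hb ⊢
      exact hb) hu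
  funext x
  have := congrFun hmain x
  simp only [zero_mul, sub_zero, Pi.zero_apply] at this
  exact this

/-! ## Real scalar functions and real vector fields -/

/-- `Δ̇_j (g_κ ⋆ f) = Δ̇_j f` (`κ = 2^{m+2}`, `j + 1 ≤ m`) for real `f ∈ L²`. [folklore] -/
theorem blockFn_lowPass_eq_self_real {m j : ℤ} (h : j + 1 ≤ m) {f : E → ℝ} (hf : MemLp f 2 volume) :
    blockFn j (lowPassKernel E ((2 : ℝ) ^ (m + 2)) ⋆[ContinuousLinearMap.lsmul ℝ ℝ, volume] f) = blockFn j f := by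
  haveI : Fact (1 ≤ (2 : ℝ≥0∞)) := ⟨one_le_two⟩
  have hκ : (0 : ℝ) < (2 : ℝ) ^ (m + 2) := zpow_pos two_pos _
  have hC := blockFn_lowPass_eq_self h (memLp_ofReal hf)
  rw [lowPass_ofReal, blockFn_ofReal j (memLp_lowPass hκ hf).1, blockFn_ofReal j hf] at hC
  funext x
  exact_mod_cast congrFun hC x

/-- `Δ̇_j (g_κ ⋆ f) = 0` (`κ = 2^{m+2}`, `m + 2 ≤ j`) for real `f ∈ L²`. [folklore] -/
theorem blockFn_lowPass_eq_zero_real {m j : ℤ} (h : m + 2 ≤ j) {f : E → ℝ} (hf : MemLp f 2 volume) :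
    blockFn j (lowPassKernel E ((2 : ℝ) ^ (m + 2)) ⋆[ContinuousLinearMap.lsmul ℝ ℝ, volume] f) = 0 := by
  haveI : Fact (1 ≤ (2 : ℝ≥0∞)) := ⟨one_le_two⟩
  have hκ : (0 : ℝ) < (2 : ℝ) ^ (m + 2) := zpow_pos two_pos _
  have hC := blockFn_lowPass_eq_zero h (memLp_ofReal hf)
  rw [lowPass_ofReal, blockFn_ofReal j (memLp_lowPass hκ hf).1] at hC
  funext x
  have := congrFun hC x
  simp only [Pi.zero_apply, Complex.ofReal_eq_zero] at this
  exact this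

variable {ι : Type*} [Fintype ι]

/-- The coordinates of the block of an `L^p` vector field: `(Δ̇_j w)(x)_l = Δ̇_j (w_l)(x)`. [folklore] -/
theorem blockFn_apply_coord (j : ℤ) {w : E → EuclideanSpace ℝ ι} {p : ℝ≥0∞} [Fact (1 ≤ p)]
    (hw : MemLp w p volume) (x : E) (l : ι) :
    blockFn j w x l = blockFn j (fun z => w z l) x := by
  have h1 := congrFun (blockFn_comp_clm j (EuclideanSpace.proj (𝕜 := ℝ) l) hw) x
  exact h1.symm

/-- `Δ̇_j (g_κ ⋆ w) = Δ̇_j w` (`κ = 2^{m+2}`, `j + 1 ≤ m`) for real vector fields `w ∈ L²`. [folklore] -/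
theorem blockFn_lowPass_eq_self_euclidean {m j : ℤ} (h : j + 1 ≤ m) {w : E → EuclideanSpace ℝ ι}
    (hw : MemLp w 2 volume) :
    blockFn j (lowPassKernel E ((2 : ℝ) ^ (m + 2)) ⋆[ContinuousLinearMap.lsmul ℝ ℝ, volume] w) = blockFn j w := by
  haveI : Fact (1 ≤ (2 : ℝ≥0∞)) := ⟨one_le_two⟩
  have hκ : (0 : ℝ) < (2 : ℝ) ^ (m + 2) := zpow_pos two_pos _
  funext x
  refine PiLp.ext fun l => ?_
  rw [blockFn_apply_coord j (memLp_lowPass hκ hw).1 x l, blockFn_apply_coord j hw x l]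
  have hcoord : (fun z => (lowPassKernel E ((2 : ℝ) ^ (m + 2)) ⋆[ContinuousLinearMap.lsmul ℝ ℝ, volume] w) z l) =
      lowPassKernel E ((2 : ℝ) ^ (m + 2)) ⋆[ContinuousLinearMap.lsmul ℝ ℝ, volume] (fun z => w z l) := by
    funext z; exact lowPass_apply_coord hκ hw z l
  rw [hcoord, blockFn_lowPass_eq_self_real h (memLp_euclidean_proj hw l)]

/-- `Δ̇_j (g_κ ⋆ w) = 0` (`κ = 2^{m+2}`, `m + 2 ≤ j`) for real vector fields `w ∈ L²`. [folklore] -/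
theorem blockFn_lowPass_eq_zero_euclidean {m j : ℤ} (h : m + 2 ≤ j) {w : E → EuclideanSpace ℝ ι}
    (hw : MemLp w 2 volume) :
    blockFn j (lowPassKernel E ((2 : ℝ) ^ (m + 2)) ⋆[ContinuousLinearMap.lsmul ℝ ℝ, volume] w) = 0 := by
  haveI : Fact (1 ≤ (2 : ℝ≥0∞)) := ⟨one_le_two⟩
  have hκ : (0 : ℝ) < (2 : ℝ) ^ (m + 2) := zpow_pos two_pos _
  funext x
  refine PiLp.ext fun l => ?_
  rw [blockFn_apply_coord j (memLp_lowPass hκ hw).1 x l]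
  have hcoord : (fun z => (lowPassKernel E ((2 : ℝ) ^ (m + 2)) ⋆[ContinuousLinearMap.lsmul ℝ ℝ, volume] w) z l) =
      lowPassKernel E ((2 : ℝ) ^ (m + 2)) ⋆[ContinuousLinearMap.lsmul ℝ ℝ, volume] (fun z => w z l) := by
    funext z; exact lowPass_apply_coord hκ hw z l
  rw [hcoord, blockFn_lowPass_eq_zero_real h (memLp_euclidean_proj hw l)]
  simp

end Literature.Analysis.FluidPDE
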